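import Mathlib
import HarnessLib

/-!
# Crux K2 `PoloidalWindowRigidity` (stmt-NavierStokesRegularity-19708), line `z_shock` — R3 infrastructure, part 1: the smooth MOVING
# CUTOFF `χ_a(⟨y⟩ + c s)` of the energy method on cones, in `ℝⁿ`, at speed `c`

`--supports stmt-NavierStokesRegularity-19708 --as helper` (leafhand-ns-poloidalwindowdoor-3 g5, cell decomp-ns, 2026-08-31).
**No stub and no summit is closed by this file; Navier–Stokes regularity is NOT proved here (rung 0).**

WHY THIS FILE.  The deciding stub `stub_zShockThickAut` of `Cruxes/PoloidalWindowRigidity/Lines/z_shock.lean` needs rung R3 of the card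
(two-sided eternal rigidity of the autonomous height-evolution `w_zz + divₕ(G(w)∇ₕw) = 0` in `2+1` dimensions); hand 3-g4 landed its local
ingredients (wave-energy identity + pointwise flux dominance, `…ZShockWaveEnergy`) and named the INTEGRATED form — «disc/cone integration +
divergence theorem (domain of dependence)» — as the Lean infrastructure gap of any energy method on the thick column.  The companion file
`…ZShockLocalEnergy` closes it (local energy inequality with a source, any dimension `n`, any speed `c`); this file carries the calculus of
the smooth moving cutoff it integrates against (the method of the tree's Glassey–Strauss cone estimate
`Literature/Barriers/QuantumFields/NoClassicalGlueballsConeEstimateProofs.lean`, `n = 3`, `c = 1`, whose method is re-run here on `ℝⁿ` with a speed: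
that module is outside this summit's farm build closure, so nothing is imported from it — the bracket lemmas below are the `ℝⁿ` instances and
the profile lemmas the offset form `u ↦ smoothTransition (b − u)` of its `n = 3` tools):

* bracket `⟨y⟩ = √(1 + |y|²)` (smooth, `|y| ≤ ⟨y⟩`, `d⟨y⟩ = ⟨y⟩⁻¹⟪y, ·⟫`); profile `χ_a(u) = smoothTransition (a + 1 − u)` (`= 1` for `u ≤ a`,
  `= 0` for `u ≥ a + 1`, `0 ≤ χ_a ≤ 1`, `χ_a' ≤ 0`);
* moving cutoff `y ↦ χ_a(⟨y⟩ + c s)`: smooth in `(s, y)`, compactly supported in `y` (in the ball of radius `a + 1 − cs`),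
  `∂ᵢχ = χ_a'(⟨y⟩ + cs)·yᵢ/⟨y⟩`, `∂ₛχ = c·χ_a'(⟨y⟩ + cs)`; integrability of `χ·h`, `χ'·h` for continuous `h`;
* `integral_mul_fderiv_eq_neg_of_hasCompactSupport`: `∫ ψ ∂ᵥg = −∫ (∂ᵥψ) g` for `C¹` compactly supported `ψ` and `C¹` `g` on `ℝⁿ`
  (Mathlib `integral_mul_fderiv_eq_neg_fderiv_mul_of_integrable`).
[folklore]
-/

noncomputable section

namespace Summit.NavierStokesRegularity.NavierStokesRegularity.Theorems.PoloidalWindowDoorPoloidalWindowRigidityZShockLocalEnergyCutoff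

-- the problem directory repeats the summit name (`NavierStokesRegularity/NavierStokesRegularity`)
set_option linter.dupNamespace false

open MeasureTheory Set Filter Topology Function Metric
open scoped ContDiff

/-! ### The bracket `⟨y⟩ = √(1 + |y|²)` -/

section Bracket

variable {n : ℕ}

/-- `⟨y⟩ = √(1 + |y|²)` is smooth on `ℝⁿ`. [folklore] -/
theorem contDiff_bracket {k : WithTop ℕ∞} :
    ContDiff ℝ k fun y : EuclideanSpace ℝ (Fin n) => √(1 + ‖y‖ ^ 2) :=
  (contDiff_const.add (contDiff_norm_sq ℝ)).sqrt fun y => by positivity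

/-- `0 < ⟨y⟩` on `ℝⁿ`. [folklore] -/
theorem bracket_pos (y : EuclideanSpace ℝ (Fin n)) : 0 < √(1 + ‖y‖ ^ 2) :=
  Real.sqrt_pos.2 (by positivity)

/-- `|y| ≤ ⟨y⟩` on `ℝⁿ`. [folklore] -/
theorem norm_le_bracket (y : EuclideanSpace ℝ (Fin n)) : ‖y‖ ≤ √(1 + ‖y‖ ^ 2) :=
  calc ‖y‖ = √(‖y‖ ^ 2) := (Real.sqrt_sq (norm_nonneg _)).symm
    _ ≤ √(1 + ‖y‖ ^ 2) := Real.sqrt_le_sqrt (by linarith)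

/-- The derivative of the bracket on `ℝⁿ`: `d⟨y⟩ = ⟨y⟩⁻¹ ⟪y, ·⟫`. [folklore] -/
theorem hasFDerivAt_bracket (y : EuclideanSpace ℝ (Fin n)) :
    HasFDerivAt (fun z : EuclideanSpace ℝ (Fin n) => √(1 + ‖z‖ ^ 2)) ((√(1 + ‖y‖ ^ 2))⁻¹ • innerSL ℝ y) y := by
  have h := ((hasStrictFDerivAt_norm_sq y).hasFDerivAt.const_add 1).sqrt (by positivity)
  refine h.congr_fderiv ?_
  rw [← Nat.cast_smul_eq_nsmul ℝ 2 (innerSL ℝ y), smul_smul]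
  congr 1
  have := bracket_pos y
  push_cast
  field_simp

end Bracket

/-! ### The cutoff profile `χ_a(u) = smoothTransition (a + 1 − u)` -/

section Profile

/-- The profile `u ↦ smoothTransition (b − u)` is smooth. [folklore] -/
theorem contDiff_profile (b : ℝ) {k : ℕ∞} :
    ContDiff ℝ k fun u : ℝ => Real.smoothTransition (b - u) :=
  Real.smoothTransition.contDiff.comp (contDiff_const.sub contDiff_id)

/-- `smoothTransition (b − u) = 1` for `u + 1 ≤ b`. [folklore] -/
theorem profile_eq_one {b u : ℝ} (h : u + 1 ≤ b) : Real.smoothTransition (b - u) = 1 :=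
  Real.smoothTransition.one_of_one_le (by linarith)

/-- `smoothTransition (b − u) = 0` for `b ≤ u`. [folklore] -/
theorem profile_eq_zero {b u : ℝ} (h : b ≤ u) : Real.smoothTransition (b - u) = 0 :=
  Real.smoothTransition.zero_of_nonpos (by linarith)

/-- The derivative of the profile: `(d/du) smoothTransition (b − u) = −smoothTransition'(b − u)`. [folklore] -/
theorem hasDerivAt_profile (b u : ℝ) :
    HasDerivAt (fun v : ℝ => Real.smoothTransition (b - v))
      (-deriv Real.smoothTransition (b - u)) u := by
  have h1 : HasDerivAt Real.smoothTransition (deriv Real.smoothTransition (b - u)) (b - u) :=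
    ((Real.smoothTransition.contDiff (n := ⊤)).differentiable (by simp) _).hasDerivAt
  have h2 : HasDerivAt (fun v : ℝ => b - v) (-1) u := by
    simpa using (hasDerivAt_id u).const_sub b
  have h3 := h1.comp u h2
  rw [mul_neg_one] at h3
  exact h3

/-- The profile is non-increasing: `(d/du) smoothTransition (b − u) ≤ 0`. [folklore] -/
theorem deriv_profile_nonpos (b u : ℝ) :
    deriv (fun v : ℝ => Real.smoothTransition (b - v)) u ≤ 0 := by
  rw [(hasDerivAt_profile b u).deriv, neg_nonpos]
  exact Real.smoothTransition.monotone.deriv_nonneg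

/-- The derivative vanishes on `(b, ∞)` (where the profile is `≡ 0`). [folklore] -/
theorem deriv_profile_eq_zero {b u : ℝ} (h : b < u) :
    deriv (fun v : ℝ => Real.smoothTransition (b - v)) u = 0 := by
  have he : (fun v : ℝ => Real.smoothTransition (b - v)) =ᶠ[𝓝 u] fun _ => 0 := by
    filter_upwards [lt_mem_nhds h] with v hv
    exact profile_eq_zero hv.le
  rw [he.deriv_eq, deriv_const]

end Profile

/-! ### The moving cutoff `y ↦ χ_a(⟨y⟩ + c s)` in `ℝⁿ` -/

section MovingCutoff

variable {n : ℕ}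

/-- Outside the ball of radius `a + 1 − c s` the moving cutoff vanishes. [folklore] -/
theorem cutoff_eq_zero {a c s : ℝ} {y : EuclideanSpace ℝ (Fin n)} (hy : a + 1 - c * s < ‖y‖) :
    Real.smoothTransition (a + 1 - (√(1 + ‖y‖ ^ 2) + c * s)) = 0 :=
  profile_eq_zero (by linarith [norm_le_bracket y])

/-- … and so does its derivative factor. [folklore] -/
theorem deriv_cutoff_eq_zero {a c s : ℝ} {y : EuclideanSpace ℝ (Fin n)} (hy : a + 1 - c * s < ‖y‖) :
    deriv (fun v : ℝ => Real.smoothTransition (a + 1 - v)) (√(1 + ‖y‖ ^ 2) + c * s) = 0 :=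
  deriv_profile_eq_zero (by linarith [norm_le_bracket y])

/-- Where `⟨y⟩ + c s ≤ a` the cutoff equals `1`. [folklore] -/
theorem cutoff_eq_one {a c s : ℝ} {y : EuclideanSpace ℝ (Fin n)} (hy : √(1 + ‖y‖ ^ 2) + c * s ≤ a) :
    Real.smoothTransition (a + 1 - (√(1 + ‖y‖ ^ 2) + c * s)) = 1 :=
  profile_eq_one (by linarith)

/-- The moving cutoff is jointly smooth in `(s, y)`. [folklore] -/
theorem contDiff_cutoff_uncurry (a c : ℝ) :
    ContDiff ℝ ∞ fun p : ℝ × EuclideanSpace ℝ (Fin n) =>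
      Real.smoothTransition (a + 1 - (√(1 + ‖p.2‖ ^ 2) + c * p.1)) :=
  (contDiff_profile (a + 1)).comp
    ((contDiff_bracket.comp contDiff_snd).add (contDiff_const.mul contDiff_fst))

/-- The moving cutoff is smooth in `y`. [folklore] -/
theorem contDiff_cutoff (a c s : ℝ) {k : ℕ∞} :
    ContDiff ℝ k fun y : EuclideanSpace ℝ (Fin n) => Real.smoothTransition (a + 1 - (√(1 + ‖y‖ ^ 2) + c * s)) :=
  (contDiff_profile (a + 1)).comp (contDiff_bracket.add contDiff_const)

/-- The moving cutoff has compact support in `y`. [folklore] -/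
theorem hasCompactSupport_cutoff (a c s : ℝ) :
    HasCompactSupport fun y : EuclideanSpace ℝ (Fin n) =>
      Real.smoothTransition (a + 1 - (√(1 + ‖y‖ ^ 2) + c * s)) := by
  refine HasCompactSupport.intro (isCompact_closedBall (0 : EuclideanSpace ℝ (Fin n)) (a + 1 - c * s))
    fun y hy => ?_
  rw [mem_closedBall, dist_zero_right, not_le] at hy
  exact cutoff_eq_zero hy

/-- The derivative factor of the moving cutoff has compact support in `y`. [folklore] -/
theorem hasCompactSupport_deriv_cutoff (a c s : ℝ) :
    HasCompactSupport fun y : EuclideanSpace ℝ (Fin n) =>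
      deriv (fun v : ℝ => Real.smoothTransition (a + 1 - v)) (√(1 + ‖y‖ ^ 2) + c * s) := by
  refine HasCompactSupport.intro (isCompact_closedBall (0 : EuclideanSpace ℝ (Fin n)) (a + 1 - c * s))
    fun y hy => ?_
  rw [mem_closedBall, dist_zero_right, not_le] at hy
  exact deriv_cutoff_eq_zero hy

/-- The derivative factor is continuous in `y`. [folklore] -/
theorem continuous_deriv_cutoff (a c s : ℝ) :
    Continuous fun y : EuclideanSpace ℝ (Fin n) =>
      deriv (fun v : ℝ => Real.smoothTransition (a + 1 - v)) (√(1 + ‖y‖ ^ 2) + c * s) :=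
  ((contDiff_profile (a + 1) (k := ⊤)).continuous_deriv (by simp)).comp
    ((contDiff_bracket (k := 0)).continuous.add continuous_const)

/-- **Spatial gradient of the moving cutoff**: `∂ᵢ χ_a(⟨y⟩ + cs) = χ_a'(⟨y⟩ + cs) yᵢ/⟨y⟩`. [folklore] -/
theorem fderiv_cutoff_single (a c s : ℝ) (y : EuclideanSpace ℝ (Fin n)) (i : Fin n) :
    fderiv ℝ (fun z : EuclideanSpace ℝ (Fin n) =>
        Real.smoothTransition (a + 1 - (√(1 + ‖z‖ ^ 2) + c * s))) y (EuclideanSpace.single i 1) =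
      deriv (fun v : ℝ => Real.smoothTransition (a + 1 - v)) (√(1 + ‖y‖ ^ 2) + c * s) *
        (y i / √(1 + ‖y‖ ^ 2)) := by
  have h1 := hasDerivAt_profile (a + 1) (√(1 + ‖y‖ ^ 2) + c * s)
  have h2 := (hasFDerivAt_bracket y).add_const (c * s)
  have h := h1.comp_hasFDerivAt y h2
  have h' : HasFDerivAt (fun z : EuclideanSpace ℝ (Fin n) =>
      Real.smoothTransition (a + 1 - (√(1 + ‖z‖ ^ 2) + c * s)))
      ((-deriv Real.smoothTransition (a + 1 - (√(1 + ‖y‖ ^ 2) + c * s))) •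
        ((√(1 + ‖y‖ ^ 2))⁻¹ • innerSL ℝ y)) y := h
  rw [h'.fderiv, h1.deriv, smul_apply, smul_apply, innerSL_apply_apply,
    EuclideanSpace.inner_single_right, smul_eq_mul, smul_eq_mul]
  simp [div_eq_inv_mul]

/-- **Height derivative of the moving cutoff**: `∂ₛ χ_a(⟨y⟩ + cs) = c·χ_a'(⟨y⟩ + cs)`. [folklore] -/
theorem hasDerivAt_cutoff (a c s : ℝ) (y : EuclideanSpace ℝ (Fin n)) :
    HasDerivAt (fun s' : ℝ => Real.smoothTransition (a + 1 - (√(1 + ‖y‖ ^ 2) + c * s')))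
      (deriv (fun v : ℝ => Real.smoothTransition (a + 1 - v)) (√(1 + ‖y‖ ^ 2) + c * s) * c) s := by
  have h1 := hasDerivAt_profile (a + 1) (√(1 + ‖y‖ ^ 2) + c * s)
  have h2 : HasDerivAt (fun s' : ℝ => √(1 + ‖y‖ ^ 2) + c * s') c s := by
    simpa using ((hasDerivAt_id s).const_mul c).const_add (√(1 + ‖y‖ ^ 2))
  have h := h1.comp s h2
  rw [h1.deriv]
  exact h

/-- Integrability of `χ · h` for continuous `h`. [folklore] -/
theorem integrable_cutoff_mul (a c s : ℝ) {h : EuclideanSpace ℝ (Fin n) → ℝ} (hh : Continuous h) :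
    Integrable fun y : EuclideanSpace ℝ (Fin n) =>
      Real.smoothTransition (a + 1 - (√(1 + ‖y‖ ^ 2) + c * s)) * h y :=
  ((contDiff_cutoff a c s (k := 0)).continuous.mul hh).integrable_of_hasCompactSupport
    (hasCompactSupport_cutoff a c s).mul_right

/-- Integrability of `χ' · h` for continuous `h`. [folklore] -/
theorem integrable_deriv_cutoff_mul (a c s : ℝ) {h : EuclideanSpace ℝ (Fin n) → ℝ} (hh : Continuous h) :
    Integrable fun y : EuclideanSpace ℝ (Fin n) =>
      deriv (fun v : ℝ => Real.smoothTransition (a + 1 - v)) (√(1 + ‖y‖ ^ 2) + c * s) * h y :=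
  ((continuous_deriv_cutoff a c s).mul hh).integrable_of_hasCompactSupport
    (hasCompactSupport_deriv_cutoff a c s).mul_right

/-- Integration by parts against the compactly supported cutoff factor (any `C¹` compactly supported `ψ`, any `C¹` `g`), in one
coordinate direction: `∫ ψ ∂ᵥg = −∫ (∂ᵥψ) g` (Mathlib `integral_mul_fderiv_eq_neg_fderiv_mul_of_integrable`, the three integrability
side conditions discharged by compact support). [folklore] -/
theorem integral_mul_fderiv_eq_neg_of_hasCompactSupport {ψ g : EuclideanSpace ℝ (Fin n) → ℝ} (hψ : ContDiff ℝ 1 ψ)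
    (hψc : HasCompactSupport ψ) (hg : ContDiff ℝ 1 g) (v : EuclideanSpace ℝ (Fin n)) :
    ∫ y, ψ y * fderiv ℝ g y v = -∫ y, fderiv ℝ ψ y v * g y := by
  refine integral_mul_fderiv_eq_neg_fderiv_mul_of_integrable ?_ ?_ ?_
    (fun y _ => hψ.differentiable one_ne_zero y) (fun y _ => hg.differentiable one_ne_zero y)
  · exact (((hψ.continuous_fderiv one_ne_zero).clm_apply continuous_const).mul hg.continuous)
      |>.integrable_of_hasCompactSupport (hψc.fderiv_apply (𝕜 := ℝ) v).mul_right
  · exact (hψ.continuous.mul ((hg.continuous_fderiv one_ne_zero).clm_apply continuous_const))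
      |>.integrable_of_hasCompactSupport hψc.mul_right
  · exact (hψ.continuous.mul hg.continuous).integrable_of_hasCompactSupport hψc.mul_right

end MovingCutoff

end Summit.NavierStokesRegularity.NavierStokesRegularity.Theorems.PoloidalWindowDoorPoloidalWindowRigidityZShockLocalEnergyCutoff

end
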